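import Literature.Analysis.SegalBargmann.HermiteMultiplierStrongContinuity
import Mathlib.Analysis.Calculus.Deriv.Slope
import Mathlib.Analysis.Calculus.Deriv.Mul
import Mathlib.Analysis.Calculus.Deriv.Comp
import Mathlib.Analysis.SpecialFunctions.ExpDeriv
import Mathlib.Analysis.SpecialFunctions.Trigonometric.Bounds
import HarnessLib

/-!
# Differentiation of Hermite multiplier families in the Schwartz topology; the infinitesimal generator of the oscillator torus

Companion of `HermiteMultiplierStrongContinuity`.  The Schwartz space `𝒮(ℝ^σ, ℂ)` is a Fréchet space, not a
normed space, so "the derivative of `t ↦ T_{m_t} f` in `𝒮`" is expressed as the convergence of the difference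
quotients (slopes) in the Schwartz topology:

* `hermiteMultiplierCLM_slope` — the slope `(t − t₀)⁻¹ (T_{m_t} f − T_{m_{t₀}} f)` is the multiplier operator of
  the slope multiplier `(t − t₀)⁻¹ (m_t − m_{t₀})` (linearity of `m ↦ T_m` on Hermite coefficients);
* `tendsto_slope_hermiteMultiplierCLM_apply` — if every `t ↦ m_t(β)` is differentiable at `t₀` with derivative
  `m′(β)` and the slope multipliers are uniformly of polynomial growth, then the slopes of `t ↦ T_{m_t} f` converge
  in `𝒮` to `T_{m′} f` (from `tendsto_hermiteMultiplierCLM_apply`, i.e. Tannery's theorem on the coefficients);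
* `tendsto_slope_torusOpCLM` — **the infinitesimal generator of the oscillator torus**: for every direction
  `v ∈ ℝ^σ` and every Schwartz `f`, `d/dt|_{t=t₀} e^{i (t v)·N} f = T_{i (v·β) e^{i t₀ v·β}} f` in `𝒮`, in particular
  (`tendsto_slope_torusOpCLM_zero`) `d/dt|_{t=0} e^{i (t v)·N} f = i (v·N) f` with `v·N` the Hermite multiplier
  `β ↦ Σ_j v_j β_j`, and along the diagonal direction `v = (1,…,1)` the generator is `i N` with `N = numberOpCLM`
  the number operator (`tendsto_slope_torusOpCLM_diag`, via `hermiteMultiplierCLM_degree_apply`).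

This is the strong differentiability on `𝒮(ℝ^σ)` of the one-parameter subgroups of the oscillator torus with its
generator identified (Folland 1989, Thm 1.83 / §4.3: the Hermite functions are analytic vectors and `dμ` of the
compact Cartan acts diagonally on them); everything is proved, nothing is cited as a hypothesis.
-/

noncomputable section

open Complex SchwartzMap MeasureTheory Filter Topology
open scoped BigOperators Real NNReal

namespace Literature.Analysis.SegalBargmann

variable {σ : Type*} [Fintype σ] [DecidableEq σ]

/-! ## §1  Linearity of `m ↦ T_m` and the slope identity -/

section Linearity

variable {m m' : (σ →₀ ℕ) → ℂ} {a a' a'' : ℕ} {M M' M'' : ℝ}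

/-- `c_α(f − g) = c_α(f) − c_α(g)`. [folklore] -/
theorem hermiteCoeff_sub (α : σ →₀ ℕ) (f g : 𝓢(EuclideanSpace ℝ σ, ℂ)) :
    hermiteCoeff α (f - g) = hermiteCoeff α f - hermiteCoeff α g := by
  rw [← hermiteCoeffCLM_apply, map_sub, hermiteCoeffCLM_apply, hermiteCoeffCLM_apply]

/-- **Difference of multiplier operators**: `T_m f − T_{m′} f = T_{m − m′} f`. [folklore] -/
theorem hermiteMultiplierCLM_sub_apply (hm : IsPolyBounded m a M) (hm' : IsPolyBounded m' a' M')
    (hsub : IsPolyBounded (m - m') a'' M'') (f : 𝓢(EuclideanSpace ℝ σ, ℂ)) :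
    hermiteMultiplierCLM m hm f - hermiteMultiplierCLM m' hm' f = hermiteMultiplierCLM (m - m') hsub f := by
  refine ext_hermiteCoeff fun α => ?_
  rw [hermiteCoeff_sub, hermiteCoeff_hermiteMultiplierCLM, hermiteCoeff_hermiteMultiplierCLM,
    hermiteCoeff_hermiteMultiplierCLM, Pi.sub_apply, sub_mul]

/-- **Scalar multiples of multiplier operators**: `c • T_m f = T_{c m} f`. [folklore] -/
theorem smul_hermiteMultiplierCLM_apply (c : ℂ) (hm : IsPolyBounded m a M)
    (hcm : IsPolyBounded (c • m) a' M') (f : 𝓢(EuclideanSpace ℝ σ, ℂ)) :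
    c • hermiteMultiplierCLM m hm f = hermiteMultiplierCLM (c • m) hcm f := by
  refine ext_hermiteCoeff fun α => ?_
  rw [hermiteCoeff_smul, hermiteCoeff_hermiteMultiplierCLM, hermiteCoeff_hermiteMultiplierCLM, Pi.smul_apply,
    smul_eq_mul, mul_assoc]

omit [Fintype σ] [DecidableEq σ] in
/-- `c • m` has polynomial growth with constant `‖c‖ M`. [folklore] -/
theorem IsPolyBounded.const_smul (c : ℂ) (hm : IsPolyBounded m a M) : IsPolyBounded (c • m) a (‖c‖ * M) :=
  fun β => by
    rw [Pi.smul_apply, smul_eq_mul, norm_mul, mul_assoc]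
    exact mul_le_mul_of_nonneg_left (hm β) (norm_nonneg c)

variable {mt : ℝ → (σ →₀ ℕ) → ℂ} {t₀ : ℝ}

omit [Fintype σ] [DecidableEq σ] in
/-- Evaluation of the slope of a multiplier family at a multi-index is the slope of the scalar family. [folklore] -/
theorem slope_apply_multiIndex (mt : ℝ → (σ →₀ ℕ) → ℂ) (t₀ t : ℝ) (β : σ →₀ ℕ) :
    slope mt t₀ t β = slope (fun s => mt s β) t₀ t := by
  simp only [slope, vsub_eq_sub, Pi.smul_apply, Pi.sub_apply]

/-- **Slope identity**: `(t − t₀)⁻¹ • (T_{m_t} f − T_{m_{t₀}} f) = T_{slope m t₀ t} f`. [folklore] -/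
theorem hermiteMultiplierCLM_slope (hmt : ∀ t, IsPolyBounded (mt t) a M)
    (hs : ∀ t, IsPolyBounded (slope mt t₀ t) a' M') (f : 𝓢(EuclideanSpace ℝ σ, ℂ)) (t : ℝ) :
    ((t - t₀ : ℝ) : ℂ)⁻¹ • (hermiteMultiplierCLM (mt t) (hmt t) f - hermiteMultiplierCLM (mt t₀) (hmt t₀) f) =
      hermiteMultiplierCLM (slope mt t₀ t) (hs t) f := by
  refine ext_hermiteCoeff fun α => ?_
  rw [hermiteCoeff_smul, hermiteCoeff_sub, hermiteCoeff_hermiteMultiplierCLM, hermiteCoeff_hermiteMultiplierCLM,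
    hermiteCoeff_hermiteMultiplierCLM, slope_apply_multiIndex, slope, vsub_eq_sub, Complex.real_smul]
  push_cast
  ring

end Linearity

/-! ## §2  Differentiation of multiplier families -/

section Derivative

variable {mt : ℝ → (σ →₀ ℕ) → ℂ} {m' : (σ →₀ ℕ) → ℂ} {t₀ : ℝ} {a a' : ℕ} {M M' : ℝ}

/-- **Strong differentiability of multiplier families.**  Let `t ↦ m_t` be multipliers with
`‖m_t(β)‖ ≤ M (|β|+1)^a`, whose slopes at `t₀` satisfy `‖(t−t₀)⁻¹(m_t(β) − m_{t₀}(β))‖ ≤ M′ (|β|+1)^{a′}` uniformly in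
`t`, and such that every `t ↦ m_t(β)` has derivative `m′(β)` at `t₀`.  Then for every Schwartz `f` the difference
quotients `(t − t₀)⁻¹ (T_{m_t} f − T_{m_{t₀}} f)` converge in `𝒮(ℝ^σ, ℂ)` to `T_{m′} f` as `t → t₀`: the orbit
`t ↦ T_{m_t} f` is differentiable at `t₀` in the Schwartz topology with derivative `T_{m′} f`.
[cite: Folland1989, §1.7] -/
theorem tendsto_slope_hermiteMultiplierCLM_apply (hmt : ∀ t, IsPolyBounded (mt t) a M)
    (hs : ∀ t, IsPolyBounded (slope mt t₀ t) a' M') (hm' : IsPolyBounded m' a' M')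
    (hd : ∀ β : σ →₀ ℕ, HasDerivAt (fun t => mt t β) (m' β) t₀) (f : 𝓢(EuclideanSpace ℝ σ, ℂ)) :
    Tendsto (fun t : ℝ => ((t - t₀ : ℝ) : ℂ)⁻¹ •
        (hermiteMultiplierCLM (mt t) (hmt t) f - hermiteMultiplierCLM (mt t₀) (hmt t₀) f))
      (𝓝[≠] t₀) (𝓝 (hermiteMultiplierCLM m' hm' f)) := by
  simp_rw [hermiteMultiplierCLM_slope hmt hs f]
  refine tendsto_hermiteMultiplierCLM_apply hs hm' (fun β => ?_) f
  simp_rw [slope_apply_multiIndex]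
  exact hasDerivAt_iff_tendsto_slope.1 (hd β)

/-- The same with the real scalar `(t − t₀)⁻¹ ∈ ℝ` acting on `𝒮(ℝ^σ, ℂ)`. [folklore] -/
theorem tendsto_slope_hermiteMultiplierCLM_apply_real (hmt : ∀ t, IsPolyBounded (mt t) a M)
    (hs : ∀ t, IsPolyBounded (slope mt t₀ t) a' M') (hm' : IsPolyBounded m' a' M')
    (hd : ∀ β : σ →₀ ℕ, HasDerivAt (fun t => mt t β) (m' β) t₀) (f : 𝓢(EuclideanSpace ℝ σ, ℂ)) :
    Tendsto (fun t : ℝ => (t - t₀)⁻¹ •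
        (hermiteMultiplierCLM (mt t) (hmt t) f - hermiteMultiplierCLM (mt t₀) (hmt t₀) f))
      (𝓝[≠] t₀) (𝓝 (hermiteMultiplierCLM m' hm' f)) := by
  refine (tendsto_slope_hermiteMultiplierCLM_apply hmt hs hm' hd f).congr fun t => ?_
  rw [← Complex.coe_smul, Complex.ofReal_inv]

end Derivative

/-! ## §3  The infinitesimal generator of the oscillator torus -/

section Torus

/-- The generator multiplier of the torus direction `v ∈ ℝ^σ`: `(v·N)(β) := Σ_j v_j β_j`. [folklore] -/
def torusGenMult (v : σ → ℝ) (β : σ →₀ ℕ) : ℂ := ((∑ j, v j * (β j : ℝ) : ℝ) : ℂ)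

omit [DecidableEq σ] in
/-- `|Σ_j v_j β_j| ≤ (Σ_j |v_j|) · (|β| + 1)`. [folklore] -/
theorem abs_sum_mul_le_degree (v : σ → ℝ) (β : σ →₀ ℕ) :
    |∑ j, v j * (β j : ℝ)| ≤ (∑ j, |v j|) * ((β.degree : ℝ) + 1) := by
  refine (Finset.abs_sum_le_sum_abs _ _).trans ?_
  rw [Finset.sum_mul]
  refine Finset.sum_le_sum fun j _ => ?_
  rw [abs_mul, Nat.abs_cast]
  refine mul_le_mul_of_nonneg_left ?_ (abs_nonneg _)
  have h1 : (β j : ℝ) ≤ (β.degree : ℝ) := by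
    exact_mod_cast Finsupp.le_degree j β
  linarith

omit [DecidableEq σ] in
/-- The generator multiplier has linear growth: `|(v·N)(β)| ≤ (Σ_j |v_j|)(|β|+1)`. [folklore] -/
theorem isPolyBounded_torusGenMult (v : σ → ℝ) : IsPolyBounded (torusGenMult v) 1 (∑ j, |v j|) := fun β => by
  rw [torusGenMult, Complex.norm_real, Real.norm_eq_abs, pow_one]
  exact abs_sum_mul_le_degree v β

omit [DecidableEq σ] in
/-- The torus phase along the line `t ↦ t v`: `χ_{t v}(β) = exp(i t (v·β))`. [folklore] -/
theorem torusPhase_smul (v : σ → ℝ) (t : ℝ) (β : σ →₀ ℕ) :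
    torusPhase (t • v) β = Complex.exp (((t * ∑ j, v j * (β j : ℝ) : ℝ) : ℂ) * I) := by
  have h : (∑ j, (t • v) j * (β j : ℝ)) = t * ∑ j, v j * (β j : ℝ) := by
    rw [Finset.mul_sum]
    exact Finset.sum_congr rfl fun j _ => by simp only [Pi.smul_apply, smul_eq_mul, mul_assoc]
  rw [torusPhase, h]

omit [DecidableEq σ] in
/-- **Derivative of the torus phase along a line**: `d/dt exp(i t v·β) = i (v·β) exp(i t v·β)`. [folklore] -/
theorem hasDerivAt_torusPhase_smul (v : σ → ℝ) (β : σ →₀ ℕ) (t₀ : ℝ) :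
    HasDerivAt (fun t : ℝ => torusPhase (t • v) β)
      (I * torusGenMult v β * torusPhase (t₀ • v) β) t₀ := by
  have h1 : HasDerivAt (fun t : ℝ => (((t * ∑ j, v j * (β j : ℝ) : ℝ) : ℂ) * I))
      ((((∑ j, v j * (β j : ℝ) : ℝ)) : ℂ) * I) t₀ := by
    have h := ((hasDerivAt_id t₀).mul_const (∑ j, v j * (β j : ℝ))).ofReal_comp.mul_const I
    simpa only [id, one_mul] using h
  have h2 := (Complex.hasDerivAt_exp _).comp t₀ h1
  have h3 : (fun t : ℝ => torusPhase (t • v) β) =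
      Complex.exp ∘ fun t : ℝ => (((t * ∑ j, v j * (β j : ℝ) : ℝ) : ℂ) * I) :=
    funext fun t => by rw [Function.comp_apply, torusPhase_smul]
  rw [h3]
  refine h2.congr_deriv ?_
  rw [torusPhase_smul, torusGenMult]
  ring

omit [DecidableEq σ] in
/-- **Uniform slope bound for the torus phases**: `‖(t−t₀)⁻¹ (χ_{t v}(β) − χ_{t₀ v}(β))‖ ≤ (Σ_j |v_j|)(|β|+1)`,
from `|e^{ix} − 1| ≤ |x|`. [folklore] -/
theorem isPolyBounded_slope_torusPhase_smul (v : σ → ℝ) (t₀ t : ℝ) :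
    IsPolyBounded (slope (fun s : ℝ => torusPhase (s • v)) t₀ t) 1 (∑ j, |v j|) := fun β => by
  rw [slope_apply_multiIndex, slope, vsub_eq_sub, pow_one]
  rcases eq_or_ne t t₀ with rfl | hne
  · rw [sub_self, inv_zero, zero_smul, norm_zero]
    exact mul_nonneg (Finset.sum_nonneg fun j _ => abs_nonneg _) (by positivity)
  have hfac : torusPhase (t • v) β - torusPhase (t₀ • v) β =
      torusPhase (t₀ • v) β * (Complex.exp (I * (((t - t₀) * ∑ j, v j * (β j : ℝ) : ℝ) : ℂ)) - 1) := by
    rw [torusPhase_smul, torusPhase_smul, mul_sub, mul_one, ← Complex.exp_add]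
    congr 1
    push_cast
    ring
  rw [norm_smul, norm_inv, Real.norm_eq_abs, hfac, norm_mul, norm_torusPhase, one_mul]
  have hb : ‖Complex.exp (I * (((t - t₀) * ∑ j, v j * (β j : ℝ) : ℝ) : ℂ)) - 1‖ ≤
      |(t - t₀) * ∑ j, v j * (β j : ℝ)| := by
    simpa only [Real.norm_eq_abs] using
      (Real.norm_exp_I_mul_ofReal_sub_one_le (x := (t - t₀) * ∑ j, v j * (β j : ℝ)))
  have hpos : 0 < |t - t₀| := abs_pos.2 (sub_ne_zero.2 hne)
  calc |t - t₀|⁻¹ * ‖Complex.exp (I * (((t - t₀) * ∑ j, v j * (β j : ℝ) : ℝ) : ℂ)) - 1‖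
      ≤ |t - t₀|⁻¹ * (|t - t₀| * |∑ j, v j * (β j : ℝ)|) := by
        rw [← abs_mul]
        exact mul_le_mul_of_nonneg_left hb (inv_nonneg.2 hpos.le)
    _ = |∑ j, v j * (β j : ℝ)| := by field_simp
    _ ≤ (∑ j, |v j|) * ((β.degree : ℝ) + 1) := abs_sum_mul_le_degree v β

omit [DecidableEq σ] in
/-- The derivative multiplier `i (v·β) χ_{t₀ v}(β)` has linear growth. [folklore] -/
theorem isPolyBounded_torusGenMult_mul_torusPhase (v : σ → ℝ) (t₀ : ℝ) :
    IsPolyBounded (fun β => I * torusGenMult v β * torusPhase (t₀ • v) β) 1 (∑ j, |v j|) := fun β => by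
  rw [norm_mul, norm_mul, Complex.norm_I, one_mul, norm_torusPhase, mul_one]
  exact isPolyBounded_torusGenMult v β

/-- **The infinitesimal generator of the oscillator torus on `𝒮(ℝ^σ)`.**  For every direction `v ∈ ℝ^σ`, every
Schwartz `f` and every `t₀`, the difference quotients of the orbit `t ↦ e^{i (t v)·N} f = torusOpCLM (t v) f`
converge in the Schwartz topology:
`(t − t₀)⁻¹ (e^{i t v·N} f − e^{i t₀ v·N} f) ⟶ T_{i (v·β) e^{i t₀ v·β}} f` as `t → t₀` —
the orbit maps of the torus are strongly differentiable on all of `𝒮(ℝ^σ, ℂ)` (not only on finite Hermite sums),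
with derivative the multiplier operator of `i (v·N) e^{i t₀ v·N}`. [cite: Folland1989, Thm 1.83] -/
theorem tendsto_slope_torusOpCLM (v : σ → ℝ) (f : 𝓢(EuclideanSpace ℝ σ, ℂ)) (t₀ : ℝ) :
    Tendsto (fun t : ℝ => (t - t₀)⁻¹ • (torusOpCLM (t • v) f - torusOpCLM (t₀ • v) f)) (𝓝[≠] t₀)
      (𝓝 (hermiteMultiplierCLM (fun β => I * torusGenMult v β * torusPhase (t₀ • v) β)
        (isPolyBounded_torusGenMult_mul_torusPhase v t₀) f)) :=
  tendsto_slope_hermiteMultiplierCLM_apply_real (mt := fun s : ℝ => torusPhase (s • v))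
    (fun s => isPolyBounded_torusPhase (s • v)) (isPolyBounded_slope_torusPhase_smul v t₀)
    (isPolyBounded_torusGenMult_mul_torusPhase v t₀) (fun β => hasDerivAt_torusPhase_smul v β t₀) f

omit [DecidableEq σ] in
/-- The generator multiplier `i (v·N)` has linear growth. [folklore] -/
theorem isPolyBounded_I_mul_torusGenMult (v : σ → ℝ) :
    IsPolyBounded (fun β => I * torusGenMult v β) 1 (∑ j, |v j|) := fun β => by
  rw [norm_mul, Complex.norm_I, one_mul]
  exact isPolyBounded_torusGenMult v β

/-- **The generator at the identity**: `t⁻¹ (e^{i t v·N} f − f) ⟶ T_{i (v·β)} f = i (v·N) f` in `𝒮(ℝ^σ, ℂ)` as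
`t → 0`. [cite: Folland1989, Thm 1.83] -/
theorem tendsto_slope_torusOpCLM_zero (v : σ → ℝ) (f : 𝓢(EuclideanSpace ℝ σ, ℂ)) :
    Tendsto (fun t : ℝ => t⁻¹ • (torusOpCLM (t • v) f - f)) (𝓝[≠] 0)
      (𝓝 (hermiteMultiplierCLM (fun β => I * torusGenMult v β) (isPolyBounded_I_mul_torusGenMult v) f)) := by
  have h := tendsto_slope_torusOpCLM v f 0
  have h0 : hermiteMultiplierCLM (fun β => I * torusGenMult v β * torusPhase ((0 : ℝ) • v) β)
      (isPolyBounded_torusGenMult_mul_torusPhase v 0) =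
      hermiteMultiplierCLM (fun β => I * torusGenMult v β) (isPolyBounded_I_mul_torusGenMult v) :=
    ContinuousLinearMap.ext fun g =>
      hermiteMultiplierCLM_congr _ _ (fun β => by rw [zero_smul, torusPhase_zero, mul_one]) g
  rw [h0] at h
  refine h.congr fun t => ?_
  rw [sub_zero, zero_smul, torusOpCLM_zero, ContinuousLinearMap.id_apply]

/-! ### The diagonal direction: the number operator -/

omit [Fintype σ] [DecidableEq σ] in
/-- The degree multiplier `β ↦ |β|` has linear growth. [folklore] -/
theorem isPolyBounded_degree : IsPolyBounded (fun β : σ →₀ ℕ => (β.degree : ℂ)) 1 1 := fun β => by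
  rw [Complex.norm_natCast, one_mul, pow_one]
  linarith

/-- **The number operator is the Hermite multiplier `β ↦ |β|`**: `T_{|β|} f = N f`. [cite: Folland1989, Thm 1.83] -/
theorem hermiteMultiplierCLM_degree_apply (f : 𝓢(EuclideanSpace ℝ σ, ℂ)) :
    hermiteMultiplierCLM (fun β : σ →₀ ℕ => (β.degree : ℂ)) isPolyBounded_degree f = numberOpCLM f :=
  ext_hermiteCoeff fun α => by rw [hermiteCoeff_hermiteMultiplierCLM, hermiteCoeff_numberOpCLM]

omit [DecidableEq σ] in
/-- Along the diagonal direction `v = (1,…,1)` the generator multiplier is the degree. [folklore] -/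
theorem torusGenMult_one (β : σ →₀ ℕ) : torusGenMult (fun _ : σ => (1 : ℝ)) β = (β.degree : ℂ) := by
  rw [torusGenMult, Finsupp.degree_eq_sum]
  push_cast
  simp only [one_mul]

/-- **`d/dt|_{t=0} e^{itN} f = i N f` in `𝒮(ℝ^σ, ℂ)`**: the number operator `N = numberOpCLM` is the infinitesimal
generator of the diagonal one-parameter group `t ↦ e^{itN} = torusOpCLM (t,…,t)` of the oscillator torus, in the
strong sense on the whole Schwartz space. [cite: Folland1989, Thm 1.83] -/
theorem tendsto_slope_torusOpCLM_diag (f : 𝓢(EuclideanSpace ℝ σ, ℂ)) :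
    Tendsto (fun t : ℝ => t⁻¹ • (torusOpCLM (fun _ : σ => t) f - f)) (𝓝[≠] 0)
      (𝓝 ((I : ℂ) • numberOpCLM f)) := by
  have h := tendsto_slope_torusOpCLM_zero (fun _ : σ => (1 : ℝ)) f
  have h1 : hermiteMultiplierCLM (fun β => I * torusGenMult (fun _ : σ => (1 : ℝ)) β)
      (isPolyBounded_I_mul_torusGenMult _) f = (I : ℂ) • numberOpCLM f := by
    rw [← hermiteMultiplierCLM_degree_apply,
      smul_hermiteMultiplierCLM_apply I isPolyBounded_degree (isPolyBounded_degree.const_smul I) f]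
    exact hermiteMultiplierCLM_congr _ _ (fun β => by rw [torusGenMult_one, Pi.smul_apply, smul_eq_mul]) f
  rw [h1] at h
  refine h.congr fun t => ?_
  have h2 : (t • fun _ : σ => (1 : ℝ)) = fun _ : σ => t := funext fun _ => by simp
  rw [h2]

end Torus

end Literature.Analysis.SegalBargmann

end
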